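import Literature.MathematicalPhysics.QuantumFieldTheory.Balaban1983to89.B15Prop1LocalLettersRecord
import Literature.MathematicalPhysics.QuantumFieldTheory.Balaban1983to89.B15Prop1SliceTaylorCalculus

/-!
# `Balaban1983to89.B15Prop1IntrinsicReading` — [Balaban1989LargeFieldI] Prop. 1 p. 194 ∕ [Balaban1989LargeFieldII] pp. 357–359: THE N12∕s1 LOCAL
# ENDPOINT IN THE INTRINSIC READING OF (1.11)–(1.12) — `H_{1,k} := id` on the gauge-fixed coordinates, `J`, `Δ₁`, `(δ/δA)V` := THE TAYLOR DATA of
# print's function `B′ ↦ A(U_{k,Z}(exp(iB′)Ṽ_k))`; the letters hA, hH, hW (Proposition 4's shape), hWdV, hG and the constant bookkeeping become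
# THEOREMS, and Proposition 1 at the record follows from THREE analytic letters about that one function

statement-level skeleton of published theorems with citation tags; proofs where landed; nothing here is a claim about
the Yang–Mills mass gap

Cell pub-ymgap, HUMAN RULING D-0062 (Track A full width), seat `pub-ymgap-dag-n12-c` (R134 acceleration seat (a), strategy s1 of DAG node N12 = [B15];
generation g5, second product).  PDFs held: `paper:balaban1989-cmp122-large-field-ii` (p. 359 = PDF 5, re-read this session), `…-large-field-i` (p. 194).

THE PRINT (p. 359, verbatim from the text layer): *«we consider the variational problem for the function V′↾_Λ → A(U_{k,Z}(V′Ṽ_k)) … Fixing the gauge G₀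
for V′ we get a small configuration, and we can write V′ = exp iB′. We expand the function with respect to B′, the expansion has the same form as in the
exponentials in (1.2) … Now the condition for a critical configuration is the equation ⟨δB′, H*_{1,k}J_{k,Z}⟩ + ⟨δB′, H*_{1,k}Δ₁H_{1,k}B′⟩ +
⟨δB′, H*_{1,k}(δ/δA)V(H_{1,k}B′)⟩ = 0 (1.12) … By the inequality (1.9) the operator P₀H*_{1,k}Δ₁H_{1,k}P₀ is positive, hence invertible … Using
Proposition 4 [15] and the fixed point theorem for contractive mappings, we can easily prove that the above equation has exactly one solution … The above
equations, bounds and statements are valid for 𝔤ᶜ-valued fields»*.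

THE READING.  (1.12) is the vanishing of the derivative of print's function `g(B′) = A(U_{k,Z}(exp(iB′)Ṽ_k))` of the gauge-fixed coordinates; by (1.11)
its Taylor data at `B′ = 0` ARE print's `H*_{1,k}J_{k,Z}` (gradient), `H*_{1,k}Δ₁(ζ₀)H_{1,k}` (Hessian; Proposition 4 [15] makes `(δ/δA)V` of second order)
and `H*_{1,k}(δ/δA)V(H_{1,k}·)` (the remainder of the gradient).  The LOCAL endpoint of the N12∕s1 chain
(`B15Prop1LocalLettersRecord.exists_domain_prop1Printed_lfVarOn_std_su2_box_regular`, p501043) is stated for ABSTRACT data `F`, `H`, `Δ₁`, `dV`, `J`,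
`Fc`, `emb`, `W`; this file INSTANTIATES it at `F i := GaugeSlice … ℝ³` (the coordinates themselves), `H := id`, `J := rGrad g 0`, `Δ₁ := D(rGrad g)(0)`,
`dV := rGrad g − J − Δ₁`, `Fc i := GaugeSlice … ℂ³`, `emb := cplxSlice`, and `W :=` the second-order Taylor remainder of the complex gradient of a
holomorphic extension (on the ball at regular data; extended by the real formula elsewhere — bookkeeping only, the chain reads `W` on the ball at
regular data), using the coordinate calculus of `B15Prop1SliceTaylorCalculus` (g5, first product).

WHAT THIS FILE PROVES (no `sorry`, no definition, no `… : Prop` fact; axioms standard).  ★★★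
**`exists_domain_prop1Printed_lfVarOn_std_su2_box_intrinsic`**: `∃ a₁ > 0, B15.Prop1Printed (lfVarOn su2Chart (InstOn.std bg M₁ Z Λ k M a₁ An))` —
Proposition 1 [IV] AS PRINTED at print's instance, SU(2), parallelepipeds, `d ≥ 3`, the x₁-axial `G₀`, the p. 193 extension — from, besides the
structural ∕ constant hypotheses and the (181) covariance + `hAn` exactly as in the local endpoint, THREE LETTERS ABOUT PRINT'S FUNCTION at `eR`-regular data:
(L1) `hGc` — *«valid for 𝔤ᶜ-valued fields»* ∕ [15] Thm 1: `B′ ↦ A(U_{k,Z}(exp(iB′)·ext V_k))` agrees on the sup-ball `‖B′‖ < R` of real bond fields with a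
  function `G` complex-differentiable on the sup-ball `‖B′‖ < R` of `𝔤ᶜ`-valued bond fields and bounded by `𝓐` there;
(L2) `hlead` — (1.7)–(1.9) p. 358 for the HESSIAN of the slice function at `0`: `|⟪X, D(rGrad g)(0)X⟫ − Σ_a formDk(ιA X)_a| ≤ Cerr‖X‖²` (with the chain's
  constant conditions `hsm`, `hγle`);
(L3) `hJ` — p. 359 for the GRADIENT at `0`: `‖rGrad g 0‖ ≤ cJ·ε` at ε-regular data.
The chain's letters hA (first-variation formula), hH (`‖H‖ ≤ h₁`, here `h₁ = 1`), hW (`Prop4Hyp W (64𝓐/R³) (R/2)`), hWdV, hemb∕hemb0, hG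
(differentiability in print's coordinates) are DERIVED (`B15Prop1SliceTaylorCalculus.slice_package_of_holomorphic`: chain rule, Cauchy's estimate and the
second-order Schwarz estimate BY NAME), and the radii∕smallness `r, ρ, a, a₃, hρ, ha₃, hsmall, hr2` are CHOSEN inside
(`r = min(1/2, R/8, γR³/(1024·M⁵·(𝓐+1)))`).

HONEST SCOPE.  (i) A re-reading, not a repair: the abstract-data endpoint stands; this is its instance at the Taylor data of print's own function,
which is what (1.11)–(1.12) describe.  (ii) The three letters are NODE 00's: (L1) is [15]'s analyticity of the minimizer composed with the Wilson action
(the bound `𝓐` uniform over regular data), (L2) is (1.7) (through (1.11) the Hessian at `0` is `H*Δ₁(ζ₀)H`), (L3) is the smallness of `H*J_{k,Z}` — none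
is proved here.  (iii) `W` off the ball ∕ at non-regular data is the real Taylor remainder transported by `cplxSlice ∘ · ∘ reSlice` (so that the chain's
global intertwining hypothesis holds); nothing is claimed about it there.  (iv) `SU(2)`, parallelepipeds, `d ≥ 3`; `hAn` carried as in the local endpoint.
Count-neutral; NOT a discharge of N12; NOT summit progress; nothing continuum ∕ OS ∕ mass-gap ∕ Clay.
-/

noncomputable section

open Set Finset Metric
open scoped BigOperators Matrix RealInnerProductSpace Real InnerProductSpace

namespace Literature.MathematicalPhysics.QuantumFieldTheory.Balaban1983to89.B15Prop1IntrinsicReading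

open B15DeterminingSets GaugeField B16Sect1Backgrounds B15Prop1Carrier B8Eq17ClassAkV1
open B15Prop1LocalLettersRecord B15Prop1SliceTaylorCalculus
open B15Prop1AnalyticExtClause (cplxVec cplxSlice cplxSlice_apply norm_cplxSlice reSlice)
open B15Prop1ChartCalculusSU2 (E3)
open T4CubeChartGnomonic (SU2)
open B15Prop1ChartSU2 (su2Chart)
open B15Prop1SliceCoordinates (GaugeSlice ιA freeBonds norm_ιA_apply_le)
open T4AxialGaugeSmallField (castSite boxPlaqs)
open B6BondElimination (unitVec)
open B16Eq18Proof (box)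
open B15Extension193 (extend)
open B15ShellGauge193 (shellGauge)
open B5Bounds167Lattice (formDk ofRealCfg)
open B14.Eq213DetSet B14.Eq216Concrete B14.Eq12InteriorLocality B15Sect1Instances B15Eq177GaugeInvariance
open Literature.MathematicalPhysics.QuantumFieldTheory.BalabanImbrieJaffe1984to88.BIJ85Eq453GaugeField
open B11Prop6Scheme (Prop4Hyp)

section Std

open Classical

variable {P : Params}

/-- `Prop4Hyp` only reads the map on the open ball `‖Y‖ < a₃` (bookkeeping). [cite: Balaban1985Variational, Prop. 4 (97)–(98) pp.292–293] -/
theorem prop4Hyp_congr {𝒴 : Type*} [NormedAddCommGroup 𝒴] [NormedSpace ℂ 𝒴] {W W' : 𝒴 → 𝒴} {C₄ a₃ : ℝ} (h : Prop4Hyp W C₄ a₃)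
    (heq : ∀ Y : 𝒴, ‖Y‖ < a₃ → W' Y = W Y) : Prop4Hyp W' C₄ a₃ := by
  refine ⟨fun Y hY => ?_, h.differentiableOn.congr fun Y hY => heq Y hY⟩
  rw [heq Y hY]
  exact h.quad Y hY

/-- The radius bookkeeping: with `r = min (1/2) (min (R/8) (γR³/(1024·M⁵·(𝓐+1))))`, `0 < r ≤ 1/2`, `4r ≤ R/2` and
`(M⁵/γ)·(4·(64𝓐/R³)·2r) ≤ 1/2` (the chain's `hr`, `hr2`, `ha₃`, `hsmall` at `h₁ = 1`, `ρ = a = r`, `C₄ = 64𝓐/R³`, `a₃ = R/2`) — print's *«for ε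
sufficiently small»* bookkeeping of the contraction on p. 359. [cite: Balaban1989LargeFieldII, (1.13) p.359] -/
private theorem radius_bookkeeping {R 𝓐 γ M : ℝ} (hR : 0 < R) (h𝓐 : 0 ≤ 𝓐) (hγ : 0 < γ) (hM : 1 ≤ M) :
    let r := min (1 / 2) (min (R / 8) (γ * R ^ 3 / (1024 * M ^ 5 * (𝓐 + 1))))
    0 < r ∧ r ≤ 1 / 2 ∧ 2 * (r + r) ≤ R / 2 ∧ M ^ 5 / γ * 1 * (4 * (64 * 𝓐 / R ^ 3) * (r + r)) * 1 ≤ 1 / 2 := by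
  intro r
  have hM0 : 0 < M := by linarith
  have hM5 : 0 < M ^ 5 := by positivity
  have hden : 0 < 1024 * M ^ 5 * (𝓐 + 1) := by positivity
  have hr0 : 0 < r := lt_min (by norm_num) (lt_min (by linarith) (div_pos (by positivity) hden))
  have hr2 : r ≤ 1 / 2 := min_le_left _ _
  have hrR : r ≤ R / 8 := (min_le_right _ _).trans (min_le_left _ _)
  have hr𝓐 : r ≤ γ * R ^ 3 / (1024 * M ^ 5 * (𝓐 + 1)) := (min_le_right _ _).trans (min_le_right _ _)
  refine ⟨hr0, hr2, by linarith, ?_⟩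
  have hR3 : 0 < R ^ 3 := by positivity
  -- `M⁵/γ · 512𝓐 r / R³ ≤ 1/2`
  have h1 : r * (1024 * M ^ 5 * (𝓐 + 1)) ≤ γ * R ^ 3 := (le_div_iff₀ hden).1 hr𝓐
  have e : M ^ 5 / γ * 1 * (4 * (64 * 𝓐 / R ^ 3) * (r + r)) * 1 = (512 * M ^ 5 * 𝓐 * r) / (γ * R ^ 3) := by
    field_simp
    ring
  rw [e, div_le_iff₀ (by positivity)]
  nlinarith [mul_nonneg h𝓐 hr0.le, mul_nonneg (mul_nonneg hM5.le h𝓐) hr0.le]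

/-- ★★★ **PROPOSITION 1 [IV] AT THE RECORD IN THE INTRINSIC READING OF (1.11)–(1.12).**  The local endpoint
`B15Prop1LocalLettersRecord.exists_domain_prop1Printed_lfVarOn_std_su2_box_regular` with `F i :=` the gauge-fixed coordinates, `H := id`, `J`, `Δ₁`,
`(δ/δA)V` := the Taylor data at `0` of print's function `g = sliceFn … (A ∘ U_{k,Z}) (ext V_k)` (*«We expand the function with respect to B′»*), `W :=` the
complex Taylor remainder of the gradient of its holomorphic extension.  Letters: (L1) `hGc` (holomorphic extension to `‖B′‖ < R` in `𝔤ᶜ`, bounded by `𝓐`,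
at `eR`-regular data), (L2) `hlead` + `hsm`∕`hγle` ((1.7)–(1.9) for the Hessian at `0`), (L3) `hJ` (`‖∇g(0)‖ ≤ cJ·ε` at ε-regular data); (181) + `hk`;
`hAn`; structural hypotheses as in the chain.  Conclusion: `∃ a₁ > 0, B15.Prop1Printed (lfVarOn su2Chart (InstOn.std bg M₁ Z Λ k M a₁ An))`.
[cite: Balaban1989LargeFieldI, Prop. 1 (1.77)–(1.78) p.194, p.193; Balaban1989LargeFieldII, (1.7)–(1.9) p.358, (1.11)–(1.13) p.359;
Balaban1985Variational, Prop. 4 pp.292–293, (181) p.307] -/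
theorem exists_domain_prop1Printed_lfVarOn_std_su2_box_intrinsic (hd3 : 3 ≤ P.d) (h0 : 0 < P.d) {ι : Type}
    {av : ∀ j, Averaging P j SU2}
    (bg : DetBackground P SU2 av) (M₁ : ℕ) (Z Λ : ι → Set (Site P 0)) (k : ι → ℕ) (M : ι → ℝ)
    (An : ∀ i, ℝ → GaugeField P (k i) SU2 → Prop) (hk : ∀ i, k i ≤ P.m + P.K)
    (eR : ι → ℝ) (heR : ∀ i, 0 < eR i)
    (h181 : ∀ i (u : GaugeTransf P (k i) SU2), Cov181 bg (Bj M₁ (Z i) (k i)) (blockLift (k i) u))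
    (T : ∀ i, Finset (PBond P (k i)))
    (lo hi : ι → Fin P.d → ℤ) (n : ι → ℕ) (hn : ∀ i κ, hi i κ ≤ lo i κ + n i) (hN : ∀ i, n i + 2 < P.sitesPerDir (k i))
    (hbox : ∀ i, pts (k i) (Λ i) = (castSite '' Set.Icc (lo i) (hi i) : Set (Site P (k i))))
    (hZ : ∀ i, (boxPlaqs (lo i - 1) (hi i + 1) : Set (Plaq P (k i))) ⊆ plaqsInside (pts (k i) (Z i)))
    (hTG0 : ∀ i, T i = (box (fun κ => (hi i κ - lo i κ + 1).toNat) (lo i)).image fun x =>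
      (⟨castSite (x - unitVec ⟨0, h0⟩), ⟨0, h0⟩⟩ : PBond P (k i)))
    (hN5 : ∀ i κ, ((hi i κ - lo i κ + 1).toNat : ℤ) + 5 < P.sitesPerDir (k i))
    (K : ι → ℕ) (hK1 : ∀ i, 1 ≤ K i) (hKn : ∀ i κ, (hi i κ - lo i κ + 1).toNat ≤ K i)
    (ext : ∀ i, GaugeField P (k i) SU2 → GaugeField P (k i) SU2)
    (hext : ∀ i Vk, ext i Vk = extend (pts (k i) (Λ i)) (shellGauge Vk (lo i) (hi i)) Vk)
    (hlohi : ∀ i, lo i ≤ hi i)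
    {γ cJ bx : ℝ} (hγ : 0 < γ) (hcJ : 0 ≤ cJ) (hbx : 0 ≤ bx)
    (hbxM : ∀ i, 12 * (P.d : ℝ) * ((n i : ℝ) + 2) ^ 2 ≤ bx * (M i) ^ 2)
    {eA Cerr R 𝓐 : ι → ℝ} (heA : ∀ i, 0 < eA i) (hM : ∀ i, 1 ≤ (M i)) (hR : ∀ i, 0 < R i) (h𝓐 : ∀ i, 0 ≤ 𝓐 i)
    (n' : ι → ℕ) (hn' : ∀ i, 1 ≤ n' i)
    -- (L1) [15] Thm 1 ∕ [LF-II] p.359 «valid for 𝔤ᶜ-valued fields»: the holomorphic extension of print's function to complex bond fields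
    (hGc : ∀ i Vk, PlaqSmallOn (plaqsInside (pts (k i) (Z i ∩ (Λ i)ᶜ))) (eR i) Vk →
      ∃ G : VecField P (k i) (EuclideanSpace ℂ (Fin 3)) → ℂ, DifferentiableOn ℂ G (ball 0 (R i)) ∧
        (∀ Y ∈ ball (0 : VecField P (k i) (EuclideanSpace ℂ (Fin 3))) (R i), ‖G Y‖ ≤ 𝓐 i) ∧
        ∀ B' : VecField P (k i) E3, ‖B'‖ < R i →
          G (cplxVec B') = ((fun177std bg M₁ (Z i) (k i) (expMul su2Chart B' (ext i Vk)) : ℝ) : ℂ))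
    -- (L2) (1.7)–(1.9) p.358 for the Hessian of the slice function at `0`
    (hlead : ∀ i Vk, PlaqSmallOn (plaqsInside (pts (k i) (Z i ∩ (Λ i)ᶜ))) (eR i) Vk →
      ∀ X : GaugeSlice (pts (k i) (Λ i)) (T i) E3,
      |⟪X, (fderiv ℝ (rGrad (pts (k i) (Λ i)) (T i)
              (sliceFn (pts (k i) (Λ i)) (T i) (fun177std bg M₁ (Z i) (k i)) (ext i Vk))) 0) X⟫ -
          ∑ a : Fin 3, formDk (n' i) (fun _ : Fin P.d => P.sitesPerDir (k i))
            (ofRealCfg (fun _ : Fin P.d => P.sitesPerDir (k i)) fun j =>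
              ιA (pts (k i) (Λ i)) (T i) X ⟨j.1, j.2⟩ a)| ≤ Cerr i * ‖X‖ ^ 2)
    (hsm : ∀ i, Cerr i ≤ (4 / Real.pi ^ 2) ^ (P.d + 2) / (2 * (3 * (K i : ℝ) ^ 2 + 2 * (K i : ℝ) ^ 4)))
    (hγle : ∀ i, γ / (M i) ^ 5 ≤ (4 / Real.pi ^ 2) ^ (P.d + 2) / (2 * (3 * (K i : ℝ) ^ 2 + 2 * (K i : ℝ) ^ 4)))
    -- (L3) p.359: the gradient at `0` is small at regular data
    (hJ : ∀ i ε Vk, 0 < ε → PlaqSmallOn (plaqsInside (pts (k i) (Z i ∩ (Λ i)ᶜ))) ε Vk →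
      ‖rGrad (pts (k i) (Λ i)) (T i) (sliceFn (pts (k i) (Λ i)) (T i) (fun177std bg M₁ (Z i) (k i)) (ext i Vk)) 0‖ ≤ cJ * ε)
    (hAn : ∀ i ε Vk, 0 < ε → ε ≤ eA i → PlaqSmallOn (plaqsInside (pts (k i) (Z i ∩ (Λ i)ᶜ))) ε Vk → An i ε Vk)
    : ∃ a₁ : ι → ℝ, (∀ i, 0 < a₁ i) ∧
      B15.Prop1Printed (lfVarOn su2Chart fun i => InstOn.std bg M₁ (Z i) (Λ i) (k i) (M i) (a₁ i) (An i)) := by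
  -- the slice functions, the regularity predicate, the chosen holomorphic extensions (junk `0` off regular data)
  set gs : ∀ i, GaugeField P (k i) SU2 → GaugeSlice (pts (k i) (Λ i)) (T i) E3 → ℝ :=
    fun i Vk => sliceFn (pts (k i) (Λ i)) (T i) (fun177std bg M₁ (Z i) (k i)) (ext i Vk) with hgs
  set Rg : ∀ i, GaugeField P (k i) SU2 → Prop := fun i Vk => PlaqSmallOn (plaqsInside (pts (k i) (Z i ∩ (Λ i)ᶜ))) (eR i) Vk with hRg
  set Gsel : ∀ i, GaugeField P (k i) SU2 → VecField P (k i) (EuclideanSpace ℂ (Fin 3)) → ℂ :=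
    fun i Vk => if h : Rg i Vk then Classical.choose (hGc i Vk h) else 0 with hGsel
  have hGsel_spec : ∀ i Vk, Rg i Vk → DifferentiableOn ℂ (Gsel i Vk) (ball 0 (R i)) ∧
      (∀ Y ∈ ball (0 : VecField P (k i) (EuclideanSpace ℂ (Fin 3))) (R i), ‖Gsel i Vk Y‖ ≤ 𝓐 i) ∧
      ∀ B' : VecField P (k i) E3, ‖B'‖ < R i →
        Gsel i Vk (cplxVec B') = ((fun177std bg M₁ (Z i) (k i) (expMul su2Chart B' (ext i Vk)) : ℝ) : ℂ) := by
    intro i Vk h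
    have e : Gsel i Vk = Classical.choose (hGc i Vk h) := by simp only [hGsel, dif_pos h]
    rw [e]
    exact Classical.choose_spec (hGc i Vk h)
  -- the complex slice functions and the true remainder
  set Gs : ∀ i, GaugeField P (k i) SU2 → GaugeSlice (pts (k i) (Λ i)) (T i) (EuclideanSpace ℂ (Fin 3)) → ℂ :=
    fun i Vk Y => Gsel i Vk (ιAc (pts (k i) (Λ i)) (T i) Y) with hGs
  set dV : ∀ i, GaugeField P (k i) SU2 → GaugeSlice (pts (k i) (Λ i)) (T i) E3 → GaugeSlice (pts (k i) (Λ i)) (T i) E3 :=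
    fun i Vk X => rGrad _ _ (gs i Vk) X - rGrad _ _ (gs i Vk) 0 - fderiv ℝ (rGrad _ _ (gs i Vk)) 0 X with hdV
  set Wt : ∀ i, GaugeField P (k i) SU2 → GaugeSlice (pts (k i) (Λ i)) (T i) (EuclideanSpace ℂ (Fin 3)) →
      GaugeSlice (pts (k i) (Λ i)) (T i) (EuclideanSpace ℂ (Fin 3)) :=
    fun i Vk Y => cGrad _ _ (Gs i Vk) Y - cGrad _ _ (Gs i Vk) 0 - fderiv ℂ (cGrad _ _ (Gs i Vk)) 0 Y with hWt
  set W : ∀ i, GaugeField P (k i) SU2 → GaugeSlice (pts (k i) (Λ i)) (T i) (EuclideanSpace ℂ (Fin 3)) →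
      GaugeSlice (pts (k i) (Λ i)) (T i) (EuclideanSpace ℂ (Fin 3)) :=
    fun i Vk Y => if ‖Y‖ < R i / 2 ∧ Rg i Vk then Wt i Vk Y else cplxSlice _ _ (dV i Vk (reSlice _ _ Y)) with hW
  -- the package at regular data
  have pkg : ∀ i Vk, Rg i Vk →
      (∀ B : GaugeSlice (pts (k i) (Λ i)) (T i) E3, ‖B‖ < R i →
        DifferentiableAt ℝ (fun B' : VecField P (k i) E3 => fun177std bg M₁ (Z i) (k i) (expMul su2Chart B' (ext i Vk)))
          (ιA (pts (k i) (Λ i)) (T i) B)) ∧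
      (∀ X δ : GaugeSlice (pts (k i) (Λ i)) (T i) E3, ‖X‖ < R i →
        HasDerivAt (fun s : ℝ => gs i Vk (X + s • δ))
          (⟪δ, rGrad _ _ (gs i Vk) 0⟫_ℝ + ⟪δ, (fderiv ℝ (rGrad _ _ (gs i Vk)) 0) X⟫_ℝ + ⟪δ, dV i Vk X⟫_ℝ) 0) ∧
      Prop4Hyp (Wt i Vk) (64 * 𝓐 i / R i ^ 3) (R i / 2) ∧
      (∀ u : GaugeSlice (pts (k i) (Λ i)) (T i) E3, ‖u‖ < R i → Wt i Vk (cplxSlice _ _ u) = cplxSlice _ _ (dV i Vk u)) := by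
    intro i Vk h
    obtain ⟨hd, hb, hr⟩ := hGsel_spec i Vk h
    exact slice_package_of_holomorphic (pts (k i) (Λ i)) (T i) (fun177std bg M₁ (Z i) (k i)) (ext i Vk) (hR i) (Gsel i Vk) hd hb hr
  -- the radii
  set r : ι → ℝ := fun i => min (1 / 2) (min (R i / 8) (γ * R i ^ 3 / (1024 * M i ^ 5 * (𝓐 i + 1)))) with hr
  have hrb : ∀ i, 0 < r i ∧ r i ≤ 1 / 2 ∧ 2 * (r i + r i) ≤ R i / 2 ∧
      M i ^ 5 / γ * 1 * (4 * (64 * 𝓐 i / R i ^ 3) * (r i + r i)) * 1 ≤ 1 / 2 :=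
    fun i => radius_bookkeeping (hR i) (h𝓐 i) hγ (hM i)
  have hrR : ∀ i, r i < R i := fun i => by
    have := (hrb i).2.2.1
    linarith [hR i]
  refine exists_domain_prop1Printed_lfVarOn_std_su2_box_regular hd3 h0 bg M₁ Z Λ k M An hk eR heR h181 T
    (F := fun i => GaugeSlice (pts (k i) (Λ i)) (T i) E3)
    (fun i _ => LinearMap.id) (fun i Vk => (fderiv ℝ (rGrad _ _ (gs i Vk)) 0).toLinearMap) dV
    (Fc := fun i => GaugeSlice (pts (k i) (Λ i)) (T i) (EuclideanSpace ℂ (Fin 3)))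
    (fun i => cplxSlice (pts (k i) (Λ i)) (T i)) (fun i u v => by rw [← map_sub, norm_cplxSlice]) (fun i => map_zero _)
    W (C₄ := fun i => 64 * 𝓐 i / R i ^ 3) (a₃ := fun i => R i / 2) (a := r)
    (fun i => div_nonneg (mul_nonneg (by norm_num) (h𝓐 i)) (pow_nonneg (hR i).le 3)) (fun i => (hrb i).1)
    (fun i Vk hV => ?hW) (fun i Vk u => ?hWdV)
    (fun i Vk => rGrad _ _ (gs i Vk) 0)
    lo hi n hn hN hbox hZ hTG0 hN5 K hK1 hKn ext hext hlohi hγ zero_le_one hcJ hbx hbxM (ρ := r) (r := r)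
    (fun i => (hrb i).1) heA hM n' hn'
    (fun i Vk hV X => by simpa only [LinearMap.id_coe, id_eq, ContinuousLinearMap.coe_coe] using hlead i Vk hV X)
    hsm hγle (fun i Vk _ x => by simp) (fun i => le_of_eq (one_mul _)) (fun i => (hrb i).2.2.1) (fun i => (hrb i).2.2.2)
    (fun i Vk hV X δ hX => ?hA) hJ (fun i Vk hV B hB => ((pkg i Vk hV).1 B (hB.trans_lt (hrR i))))
    (fun i => (hrb i).2.1) hAn
  case hW =>
    -- on the ball `‖Y‖ < R/2` at regular data `W = Wt`
    refine prop4Hyp_congr (pkg i Vk hV).2.2.1 fun Y hY => ?_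
    exact if_pos ⟨hY, hV⟩
  case hWdV =>
    by_cases hc : ‖cplxSlice (pts (k i) (Λ i)) (T i) u‖ < R i / 2 ∧ Rg i Vk
    · simp only [hW, if_pos hc]
      have hu : ‖u‖ < R i := by
        have h1 := hc.1
        rw [norm_cplxSlice] at h1
        linarith [hR i]
      exact (pkg i Vk hc.2).2.2.2 u hu
    · simp only [hW, if_neg hc, reSlice_cplxSlice]
  case hA =>
    have h := (pkg i Vk hV).2.1 X δ (hX.trans_lt (hrR i))
    simpa only [LinearMap.id_coe, id_eq, ContinuousLinearMap.coe_coe, hgs, sliceFn_apply] using h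

/-! ## v1.1 (g5) — the gradient letter asked at REGULAR data only -/

/-- ★★★ **PROPOSITION 1 [IV] AT THE RECORD IN THE INTRINSIC READING — (L3) AT REGULAR DATA ONLY.**  As
`exists_domain_prop1Printed_lfVarOn_std_su2_box_intrinsic`, but the gradient letter `hJ` is asked only for `ε ≤ eR` (print's p. 359 bound on
`H*J_{k,Z}` concerns regular boundary data; the chain's global form is met by taking `J := 0` off the `eR`-regular data and `cJ·eR ≤ cJ·ε` beyond).
ORIGINAL DOCSTRING: **PROPOSITION 1 [IV] AT THE RECORD IN THE INTRINSIC READING OF (1.11)–(1.12).**  The local endpoint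
`B15Prop1LocalLettersRecord.exists_domain_prop1Printed_lfVarOn_std_su2_box_regular` with `F i :=` the gauge-fixed coordinates, `H := id`, `J`, `Δ₁`,
`(δ/δA)V` := the Taylor data at `0` of print's function `g = sliceFn … (A ∘ U_{k,Z}) (ext V_k)` (*«We expand the function with respect to B′»*), `W :=` the
complex Taylor remainder of the gradient of its holomorphic extension.  Letters: (L1) `hGc` (holomorphic extension to `‖B′‖ < R` in `𝔤ᶜ`, bounded by `𝓐`,
at `eR`-regular data), (L2) `hlead` + `hsm`∕`hγle` ((1.7)–(1.9) for the Hessian at `0`), (L3) `hJ` (`‖∇g(0)‖ ≤ cJ·ε` at ε-regular data); (181) + `hk`;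
`hAn`; structural hypotheses as in the chain.  Conclusion: `∃ a₁ > 0, B15.Prop1Printed (lfVarOn su2Chart (InstOn.std bg M₁ Z Λ k M a₁ An))`.
[cite: Balaban1989LargeFieldI, Prop. 1 (1.77)–(1.78) p.194, p.193; Balaban1989LargeFieldII, (1.7)–(1.9) p.358, (1.11)–(1.13) p.359;
Balaban1985Variational, Prop. 4 pp.292–293, (181) p.307] -/
theorem exists_domain_prop1Printed_lfVarOn_std_su2_box_intrinsic' (hd3 : 3 ≤ P.d) (h0 : 0 < P.d) {ι : Type}
    {av : ∀ j, Averaging P j SU2}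
    (bg : DetBackground P SU2 av) (M₁ : ℕ) (Z Λ : ι → Set (Site P 0)) (k : ι → ℕ) (M : ι → ℝ)
    (An : ∀ i, ℝ → GaugeField P (k i) SU2 → Prop) (hk : ∀ i, k i ≤ P.m + P.K)
    (eR : ι → ℝ) (heR : ∀ i, 0 < eR i)
    (h181 : ∀ i (u : GaugeTransf P (k i) SU2), Cov181 bg (Bj M₁ (Z i) (k i)) (blockLift (k i) u))
    (T : ∀ i, Finset (PBond P (k i)))
    (lo hi : ι → Fin P.d → ℤ) (n : ι → ℕ) (hn : ∀ i κ, hi i κ ≤ lo i κ + n i) (hN : ∀ i, n i + 2 < P.sitesPerDir (k i))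
    (hbox : ∀ i, pts (k i) (Λ i) = (castSite '' Set.Icc (lo i) (hi i) : Set (Site P (k i))))
    (hZ : ∀ i, (boxPlaqs (lo i - 1) (hi i + 1) : Set (Plaq P (k i))) ⊆ plaqsInside (pts (k i) (Z i)))
    (hTG0 : ∀ i, T i = (box (fun κ => (hi i κ - lo i κ + 1).toNat) (lo i)).image fun x =>
      (⟨castSite (x - unitVec ⟨0, h0⟩), ⟨0, h0⟩⟩ : PBond P (k i)))
    (hN5 : ∀ i κ, ((hi i κ - lo i κ + 1).toNat : ℤ) + 5 < P.sitesPerDir (k i))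
    (K : ι → ℕ) (hK1 : ∀ i, 1 ≤ K i) (hKn : ∀ i κ, (hi i κ - lo i κ + 1).toNat ≤ K i)
    (ext : ∀ i, GaugeField P (k i) SU2 → GaugeField P (k i) SU2)
    (hext : ∀ i Vk, ext i Vk = extend (pts (k i) (Λ i)) (shellGauge Vk (lo i) (hi i)) Vk)
    (hlohi : ∀ i, lo i ≤ hi i)
    {γ cJ bx : ℝ} (hγ : 0 < γ) (hcJ : 0 ≤ cJ) (hbx : 0 ≤ bx)
    (hbxM : ∀ i, 12 * (P.d : ℝ) * ((n i : ℝ) + 2) ^ 2 ≤ bx * (M i) ^ 2)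
    {eA Cerr R 𝓐 : ι → ℝ} (heA : ∀ i, 0 < eA i) (hM : ∀ i, 1 ≤ (M i)) (hR : ∀ i, 0 < R i) (h𝓐 : ∀ i, 0 ≤ 𝓐 i)
    (n' : ι → ℕ) (hn' : ∀ i, 1 ≤ n' i)
    -- (L1) [15] Thm 1 ∕ [LF-II] p.359 «valid for 𝔤ᶜ-valued fields»: the holomorphic extension of print's function to complex bond fields
    (hGc : ∀ i Vk, PlaqSmallOn (plaqsInside (pts (k i) (Z i ∩ (Λ i)ᶜ))) (eR i) Vk →
      ∃ G : VecField P (k i) (EuclideanSpace ℂ (Fin 3)) → ℂ, DifferentiableOn ℂ G (ball 0 (R i)) ∧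
        (∀ Y ∈ ball (0 : VecField P (k i) (EuclideanSpace ℂ (Fin 3))) (R i), ‖G Y‖ ≤ 𝓐 i) ∧
        ∀ B' : VecField P (k i) E3, ‖B'‖ < R i →
          G (cplxVec B') = ((fun177std bg M₁ (Z i) (k i) (expMul su2Chart B' (ext i Vk)) : ℝ) : ℂ))
    -- (L2) (1.7)–(1.9) p.358 for the Hessian of the slice function at `0`
    (hlead : ∀ i Vk, PlaqSmallOn (plaqsInside (pts (k i) (Z i ∩ (Λ i)ᶜ))) (eR i) Vk →
      ∀ X : GaugeSlice (pts (k i) (Λ i)) (T i) E3,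
      |⟪X, (fderiv ℝ (rGrad (pts (k i) (Λ i)) (T i)
              (sliceFn (pts (k i) (Λ i)) (T i) (fun177std bg M₁ (Z i) (k i)) (ext i Vk))) 0) X⟫ -
          ∑ a : Fin 3, formDk (n' i) (fun _ : Fin P.d => P.sitesPerDir (k i))
            (ofRealCfg (fun _ : Fin P.d => P.sitesPerDir (k i)) fun j =>
              ιA (pts (k i) (Λ i)) (T i) X ⟨j.1, j.2⟩ a)| ≤ Cerr i * ‖X‖ ^ 2)
    (hsm : ∀ i, Cerr i ≤ (4 / Real.pi ^ 2) ^ (P.d + 2) / (2 * (3 * (K i : ℝ) ^ 2 + 2 * (K i : ℝ) ^ 4)))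
    (hγle : ∀ i, γ / (M i) ^ 5 ≤ (4 / Real.pi ^ 2) ^ (P.d + 2) / (2 * (3 * (K i : ℝ) ^ 2 + 2 * (K i : ℝ) ^ 4)))
    -- (L3) p.359: the gradient at `0` is small at regular data
    (hJ : ∀ i ε Vk, 0 < ε → ε ≤ eR i → PlaqSmallOn (plaqsInside (pts (k i) (Z i ∩ (Λ i)ᶜ))) ε Vk →
      ‖rGrad (pts (k i) (Λ i)) (T i) (sliceFn (pts (k i) (Λ i)) (T i) (fun177std bg M₁ (Z i) (k i)) (ext i Vk)) 0‖ ≤ cJ * ε)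
    (hAn : ∀ i ε Vk, 0 < ε → ε ≤ eA i → PlaqSmallOn (plaqsInside (pts (k i) (Z i ∩ (Λ i)ᶜ))) ε Vk → An i ε Vk)
    : ∃ a₁ : ι → ℝ, (∀ i, 0 < a₁ i) ∧
      B15.Prop1Printed (lfVarOn su2Chart fun i => InstOn.std bg M₁ (Z i) (Λ i) (k i) (M i) (a₁ i) (An i)) := by
  -- the slice functions, the regularity predicate, the chosen holomorphic extensions (junk `0` off regular data)
  set gs : ∀ i, GaugeField P (k i) SU2 → GaugeSlice (pts (k i) (Λ i)) (T i) E3 → ℝ :=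
    fun i Vk => sliceFn (pts (k i) (Λ i)) (T i) (fun177std bg M₁ (Z i) (k i)) (ext i Vk) with hgs
  set Rg : ∀ i, GaugeField P (k i) SU2 → Prop := fun i Vk => PlaqSmallOn (plaqsInside (pts (k i) (Z i ∩ (Λ i)ᶜ))) (eR i) Vk with hRg
  set Gsel : ∀ i, GaugeField P (k i) SU2 → VecField P (k i) (EuclideanSpace ℂ (Fin 3)) → ℂ :=
    fun i Vk => if h : Rg i Vk then Classical.choose (hGc i Vk h) else 0 with hGsel
  have hGsel_spec : ∀ i Vk, Rg i Vk → DifferentiableOn ℂ (Gsel i Vk) (ball 0 (R i)) ∧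
      (∀ Y ∈ ball (0 : VecField P (k i) (EuclideanSpace ℂ (Fin 3))) (R i), ‖Gsel i Vk Y‖ ≤ 𝓐 i) ∧
      ∀ B' : VecField P (k i) E3, ‖B'‖ < R i →
        Gsel i Vk (cplxVec B') = ((fun177std bg M₁ (Z i) (k i) (expMul su2Chart B' (ext i Vk)) : ℝ) : ℂ) := by
    intro i Vk h
    have e : Gsel i Vk = Classical.choose (hGc i Vk h) := by simp only [hGsel, dif_pos h]
    rw [e]
    exact Classical.choose_spec (hGc i Vk h)
  -- the complex slice functions and the true remainder
  set Gs : ∀ i, GaugeField P (k i) SU2 → GaugeSlice (pts (k i) (Λ i)) (T i) (EuclideanSpace ℂ (Fin 3)) → ℂ :=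
    fun i Vk Y => Gsel i Vk (ιAc (pts (k i) (Λ i)) (T i) Y) with hGs
  set dV : ∀ i, GaugeField P (k i) SU2 → GaugeSlice (pts (k i) (Λ i)) (T i) E3 → GaugeSlice (pts (k i) (Λ i)) (T i) E3 :=
    fun i Vk X => rGrad _ _ (gs i Vk) X - rGrad _ _ (gs i Vk) 0 - fderiv ℝ (rGrad _ _ (gs i Vk)) 0 X with hdV
  set Wt : ∀ i, GaugeField P (k i) SU2 → GaugeSlice (pts (k i) (Λ i)) (T i) (EuclideanSpace ℂ (Fin 3)) →
      GaugeSlice (pts (k i) (Λ i)) (T i) (EuclideanSpace ℂ (Fin 3)) :=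
    fun i Vk Y => cGrad _ _ (Gs i Vk) Y - cGrad _ _ (Gs i Vk) 0 - fderiv ℂ (cGrad _ _ (Gs i Vk)) 0 Y with hWt
  set W : ∀ i, GaugeField P (k i) SU2 → GaugeSlice (pts (k i) (Λ i)) (T i) (EuclideanSpace ℂ (Fin 3)) →
      GaugeSlice (pts (k i) (Λ i)) (T i) (EuclideanSpace ℂ (Fin 3)) :=
    fun i Vk Y => if ‖Y‖ < R i / 2 ∧ Rg i Vk then Wt i Vk Y else cplxSlice _ _ (dV i Vk (reSlice _ _ Y)) with hW
  -- the package at regular data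
  have pkg : ∀ i Vk, Rg i Vk →
      (∀ B : GaugeSlice (pts (k i) (Λ i)) (T i) E3, ‖B‖ < R i →
        DifferentiableAt ℝ (fun B' : VecField P (k i) E3 => fun177std bg M₁ (Z i) (k i) (expMul su2Chart B' (ext i Vk)))
          (ιA (pts (k i) (Λ i)) (T i) B)) ∧
      (∀ X δ : GaugeSlice (pts (k i) (Λ i)) (T i) E3, ‖X‖ < R i →
        HasDerivAt (fun s : ℝ => gs i Vk (X + s • δ))
          (⟪δ, rGrad _ _ (gs i Vk) 0⟫_ℝ + ⟪δ, (fderiv ℝ (rGrad _ _ (gs i Vk)) 0) X⟫_ℝ + ⟪δ, dV i Vk X⟫_ℝ) 0) ∧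
      Prop4Hyp (Wt i Vk) (64 * 𝓐 i / R i ^ 3) (R i / 2) ∧
      (∀ u : GaugeSlice (pts (k i) (Λ i)) (T i) E3, ‖u‖ < R i → Wt i Vk (cplxSlice _ _ u) = cplxSlice _ _ (dV i Vk u)) := by
    intro i Vk h
    obtain ⟨hd, hb, hr⟩ := hGsel_spec i Vk h
    exact slice_package_of_holomorphic (pts (k i) (Λ i)) (T i) (fun177std bg M₁ (Z i) (k i)) (ext i Vk) (hR i) (Gsel i Vk) hd hb hr
  -- the radii
  set r : ι → ℝ := fun i => min (1 / 2) (min (R i / 8) (γ * R i ^ 3 / (1024 * M i ^ 5 * (𝓐 i + 1)))) with hr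
  have hrb : ∀ i, 0 < r i ∧ r i ≤ 1 / 2 ∧ 2 * (r i + r i) ≤ R i / 2 ∧
      M i ^ 5 / γ * 1 * (4 * (64 * 𝓐 i / R i ^ 3) * (r i + r i)) * 1 ≤ 1 / 2 :=
    fun i => radius_bookkeeping (hR i) (h𝓐 i) hγ (hM i)
  have hrR : ∀ i, r i < R i := fun i => by
    have := (hrb i).2.2.1
    linarith [hR i]
  refine exists_domain_prop1Printed_lfVarOn_std_su2_box_regular hd3 h0 bg M₁ Z Λ k M An hk eR heR h181 T
    (F := fun i => GaugeSlice (pts (k i) (Λ i)) (T i) E3)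
    (fun i _ => LinearMap.id) (fun i Vk => (fderiv ℝ (rGrad _ _ (gs i Vk)) 0).toLinearMap) dV
    (Fc := fun i => GaugeSlice (pts (k i) (Λ i)) (T i) (EuclideanSpace ℂ (Fin 3)))
    (fun i => cplxSlice (pts (k i) (Λ i)) (T i)) (fun i u v => by rw [← map_sub, norm_cplxSlice]) (fun i => map_zero _)
    W (C₄ := fun i => 64 * 𝓐 i / R i ^ 3) (a₃ := fun i => R i / 2) (a := r)
    (fun i => div_nonneg (mul_nonneg (by norm_num) (h𝓐 i)) (pow_nonneg (hR i).le 3)) (fun i => (hrb i).1)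
    (fun i Vk hV => ?hW) (fun i Vk u => ?hWdV)
    (fun i Vk => if Rg i Vk then rGrad _ _ (gs i Vk) 0 else 0)
    lo hi n hn hN hbox hZ hTG0 hN5 K hK1 hKn ext hext hlohi hγ zero_le_one hcJ hbx hbxM (ρ := r) (r := r)
    (fun i => (hrb i).1) heA hM n' hn'
    (fun i Vk hV X => by simpa only [LinearMap.id_coe, id_eq, ContinuousLinearMap.coe_coe] using hlead i Vk hV X)
    hsm hγle (fun i Vk _ x => by simp) (fun i => le_of_eq (one_mul _)) (fun i => (hrb i).2.2.1) (fun i => (hrb i).2.2.2)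
    (fun i Vk hV X δ hX => ?hA) (fun i ε Vk hε hV => ?hJ) (fun i Vk hV B hB => ((pkg i Vk hV).1 B (hB.trans_lt (hrR i))))
    (fun i => (hrb i).2.1) hAn
  case hW =>
    -- on the ball `‖Y‖ < R/2` at regular data `W = Wt`
    refine prop4Hyp_congr (pkg i Vk hV).2.2.1 fun Y hY => ?_
    exact if_pos ⟨hY, hV⟩
  case hWdV =>
    by_cases hc : ‖cplxSlice (pts (k i) (Λ i)) (T i) u‖ < R i / 2 ∧ Rg i Vk
    · simp only [hW, if_pos hc]
      have hu : ‖u‖ < R i := by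
        have h1 := hc.1
        rw [norm_cplxSlice] at h1
        linarith [hR i]
      exact (pkg i Vk hc.2).2.2.2 u hu
    · simp only [hW, if_neg hc, reSlice_cplxSlice]
  case hA =>
    have hV' : Rg i Vk := hV
    have h := (pkg i Vk hV).2.1 X δ (hX.trans_lt (hrR i))
    simpa only [LinearMap.id_coe, id_eq, ContinuousLinearMap.coe_coe, hgs, sliceFn_apply, if_pos hV'] using h
  case hJ =>
    by_cases hreg : Rg i Vk
    · rw [if_pos hreg]
      by_cases hle : ε ≤ eR i
      · exact hJ i ε Vk hε hle hV
      · have h := hJ i (eR i) Vk (heR i) le_rfl hreg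
        exact h.trans (mul_le_mul_of_nonneg_left (le_of_lt (lt_of_not_ge hle)) hcJ)
    · rw [if_neg hreg, norm_zero]
      exact mul_nonneg hcJ hε.le

end Std

end Literature.MathematicalPhysics.QuantumFieldTheory.Balaban1983to89.B15Prop1IntrinsicReading

end
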